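import Summits.NavierStokesRegularity.FunctionalMining.TopEigHeatConvex
import Summits.NavierStokesRegularity.FunctionalMining.TopEigHeatCoerciveGap
import Literature.Analysis.FunctionSpaces.TorusInverseLaplacianCalculus
import Mathlib.Tactic.Module
import HarnessLib

/-!
# FunctionalMining / NoGo — the SHIFTED HEAT IDENTITY and TWO-SHELL fields (door (c), node K6)

search for candidate a priori estimates; no regularity claim. Cell `pub-nsfunc`, nogo seat
(gen 47). Lemma L-λ(q) = `TopEig.TopEigHeatCoercivePos q` is OPEN in the kernel for every real
`q > 1`; this file decides no node. It types the first constraints on GENUINELY 3-D designs for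
the wanted kill (F2) (`det S ≢ 0`; outside the laminate / singular-strain / gap classes):
superpositions `u + w` of two Laplace eigenfields `Δu = −c₁u`, `Δw = −c₂w`, `c₁ < c₂` (e.g. two
ABC / Beltrami shells). Write `Φ` for either one-sided core `∫(λ₁⁺)^q`, `∫((−λ₃)⁺)^q`, `q ≥ 1`.
* `heatLine_shift`: `Δv = −c₁v − z` ⇒ the explicit heat step is a DILATED SLICE,
  `v + tΔv = (1 − c₁t) • (v − (t/(1 − c₁t)) z)`; `laplacian_twoShell`: `z = (c₂ − c₁) w`.
* `heatDissipation_topEigMoment_shift` (homogeneity `torusTopEigMoment_smul` + convexity of the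
  slice `σ ↦ Φ(v − σz)`, tree `convexOn_topEigMoment_line`): `heatDissipation Φ v =
  q c₁ Φ(v) − ∂σ⁺|₀ Φ(v − σz)` — the heat price is a one-sided SLICE derivative (it exists by
  convexity); its secant bounds (Mathlib `ConvexOn.rightDeriv_le_slope_of_mem_interior`,
  `slope_le_leftDeriv_of_mem_interior`), for every `τ > 0`:
  `q c₁ Φ(v) + (Φ(v) − Φ(v − τz))/τ ≤ heatDissipation Φ v ≤ q c₁ Φ(v) + (Φ(v + τz) − Φ(v))/τ`
  (`…_shift_ge` / `…_shift_le`, both cores).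
* TWO SHELLS (`τ = 1/(c₂ − c₁)`), the SANDWICH `twoShell_sandwich_top/_negBot`:
  `(c₂ − c₁)(Φ(u+w) − Φ(u)) ≤ heatDissipation Φ (u+w) − q c₁ Φ(u+w) ≤ (c₂ − c₁)(Φ(u+2w) − Φ(u+w))`;
  hence (i) `twoShell_coercive_of_moment_le`: if the high shell does not LOWER the moment
  (`Φ(u) ≤ Φ(u + w)`) the field is coercive at the single-shell rate `q c₁` of its LOW shell — class
  form `heatCoerciveOn_twoShellMono_top/_negBot`; (ii) `twoShell_moment_lt_of_kill`: a two-shell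
  violator `heatDissipation Φ (u+w) < c Φ(u+w)`, `c ≤ q c₁`, has `(q c₁ − c) Φ(u+w) <
  (c₂ − c₁)(Φ(u) − Φ(u+w))`, so `Φ(u+w) < Φ(u)` — destructive interference of the eigenvalue is
  NECESSARY; (iii) `twoShell_kill_of_moment_drop`: `(q c₁ − c) Φ(u+w) < (c₂ − c₁)(Φ(u+w) − Φ(u+2w))`
  CERTIFIES `heatDissipation Φ (u+w) < c Φ(u+w)` — a sufficient, heat-flow-free test for (F2)
  candidates; (iv) `twoShell_moment_drop_le`: on `T³`, for divergence-free shells, the heat sieve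
  `0 ≤ heatDissipation` (tree `heatDissipation_nonneg_of_admissible`) IS the three-moment inequality
  `(c₂ − c₁)(Φ(u+w) − Φ(u+2w)) ≤ q c₁ Φ(u+w)` (`λ₁` core).
Scope, exactly: real `q ≥ 1`; `c₁ < c₂` real in §4–§5 (`c₁ = c₂` is the tree calibration
`heatDissipation_topEigMoment_of_laplacian_eq`); any finite index type `d`, except `T³` +
divergence-free in (iv); `HeatCoerciveOn` carries its own `T³` / div-free / zero-mean binders.
No sharpness claim; no node decided. [ours, calibration / bookkeeping; the one-sided calculus of
convex functions is folklore (Mathlib `Analysis.Convex.Deriv`)]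
FILING (prove seat g28, REQUEST #60): declarations byte-identical to the no-go seat's staged `TopEigHeatTwoShell.STAGING.lean` f08604f24db716ee; this line is the only addition.
-/


noncomputable section

open MeasureTheory Set Filter Topology
open scoped InnerProductSpace RealInnerProductSpace ContDiff

namespace Summit.NavierStokesRegularity.FunctionalMining

open Literature.Analysis.FunctionSpaces Literature.Analysis.FluidPDE

namespace TopEig

variable {d : Type*} [Fintype d] [DecidableEq d]

/-! ## 1. The shifted heat line is a dilated slice -/

omit [DecidableEq d] in
/-- If `Δv = −c₁ v − z` then `v + tΔv = (1 − c₁t) • (v + (t/(1 − c₁t)) • (−z))` whenever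
`1 − c₁ t ≠ 0`. [ours, bookkeeping] -/
theorem heatLine_shift {v z : UnitAddTorus d → EuclideanSpace ℝ d} {c₁ t : ℝ}
    (hz : Torus.laplacian v = -(c₁ • v) - z) (ht : 1 - c₁ * t ≠ 0) :
    v + t • Torus.laplacian v = (1 - c₁ * t) • (v + (t / (1 - c₁ * t)) • (-z)) := by
  have hmul : (1 - c₁ * t) * (t / (1 - c₁ * t)) = t := mul_div_cancel₀ t ht
  rw [hz, smul_add, smul_smul, hmul]
  module

/-- Two Laplace eigenfields: `Δu = −c₁u`, `Δw = −c₂w` ⇒ `Δ(u + w) = −c₁(u + w) − (c₂ − c₁) w`.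
[ours, bookkeeping] -/
theorem laplacian_twoShell {u w : UnitAddTorus d → EuclideanSpace ℝ d} {c₁ c₂ : ℝ}
    (hu : Torus.IsSmooth u) (hw : Torus.IsSmooth w)
    (hΔu : Torus.laplacian u = -(c₁ • u)) (hΔw : Torus.laplacian w = -(c₂ • w)) :
    Torus.laplacian (u + w) = -(c₁ • (u + w)) - (c₂ - c₁) • w := by
  funext x
  rw [Literature.Analysis.FunctionSpaces.Torus.laplacian_add_apply hu hw, hΔu, hΔw]
  simp only [Pi.neg_apply, Pi.smul_apply, Pi.sub_apply, Pi.add_apply, smul_add, sub_smul]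
  module

/-! ## 2. The shifted heat identity for the `λ₁` core -/

/-- **Shifted heat identity (`λ₁` core).** For smooth `v, z` with `Δv = −c₁v − z` and `q ≥ 1`:
the slice `σ ↦ ∫(λ₁⁺)^q(v − σz)` has a right derivative `m` at `0` (convexity), and
`heatDissipation (∫(λ₁⁺)^q) v = q c₁ ∫(λ₁⁺)^q(v) − m`. [ours, calibration] -/
theorem heatDissipation_topEigMoment_shift [Nonempty d] {q : ℝ} (hq : 1 ≤ q) {c₁ : ℝ}
    {v z : UnitAddTorus d → EuclideanSpace ℝ d} (hv : Torus.IsSmooth v) (hz : Torus.IsSmooth z)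
    (hΔ : Torus.laplacian v = -(c₁ • v) - z) :
    HasDerivWithinAt (fun σ : ℝ => torusTopEigMoment q (v + σ • (-z)))
        (derivWithin (fun σ : ℝ => torusTopEigMoment q (v + σ • (-z))) (Set.Ioi 0) 0) (Set.Ioi 0) 0 ∧
      heatDissipation (torusTopEigMoment q) v = q * c₁ * torusTopEigMoment q v -
        derivWithin (fun σ : ℝ => torusTopEigMoment q (v + σ • (-z))) (Set.Ioi 0) 0 := by
  set h : ℝ → ℝ := fun σ => torusTopEigMoment q (v + σ • (-z)) with hh_def
  set m : ℝ := derivWithin h (Set.Ioi 0) 0 with hm_def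
  have hconv : ConvexOn ℝ univ h := convexOn_topEigMoment_line hq hv hz.neg
  have h0 : (0 : ℝ) ∈ interior (univ : Set ℝ) := by simp
  have hh : HasDerivWithinAt h m (Set.Ioi 0) 0 := hconv.hasDerivWithinAt_rightDeriv_of_mem_interior h0
  refine ⟨hh, ?_⟩  -- the identity: differentiate `t ↦ (1 - c₁t)^q · h(σ t)` at `0⁺`
  obtain ⟨-, hD⟩ := heatDissipation_topEigMoment_eq hq hv
  set f : ℝ → ℝ := fun t => torusTopEigMoment q (v + t • Torus.laplacian v) with hf_def
  -- a small interval on which `1 - c₁ t > 0`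
  set δ : ℝ := 1 / (|c₁| + 1) with hδ
  have hδ0 : 0 < δ := by rw [hδ]; positivity
  have hpos : ∀ t ∈ Set.Ioo (0 : ℝ) δ, 0 < 1 - c₁ * t := by
    intro t ht
    have h3 : |c₁| * δ < 1 := by
      rw [hδ, mul_one_div, div_lt_one (by positivity)]; linarith [abs_nonneg c₁]
    nlinarith [le_abs_self c₁, ht.1, ht.2, abs_nonneg c₁]
  -- the inner map `σ(t) = t / (1 - c₁ t)` and the dilation factor `(1 - c₁ t)^q`
  have h1 : HasDerivAt (fun t : ℝ => 1 - c₁ * t) (-c₁) 0 := by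
    simpa using ((hasDerivAt_id (0 : ℝ)).const_mul c₁).const_sub 1
  set σ : ℝ → ℝ := fun t => t / (1 - c₁ * t) with hσ_def
  have hσ0 : σ 0 = 0 := by simp [hσ_def]
  have hσd : HasDerivAt σ 1 0 := by
    have h2 := (hasDerivAt_id (0 : ℝ)).div h1 (by simp)
    have e : ((1 : ℝ) * (1 - c₁ * 0) - id (0 : ℝ) * -c₁) / (1 - c₁ * 0) ^ 2 = 1 := by simp
    rw [e] at h2
    exact h2
  have hmaps : MapsTo σ (Set.Ioo 0 δ) (Set.Ioi 0) := fun t ht => div_pos ht.1 (hpos t ht)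
  have hH : HasDerivWithinAt (h ∘ σ) (m * 1) (Set.Ioo 0 δ) 0 := by
    have hh' : HasDerivWithinAt h m (Set.Ioi 0) (σ 0) := by rw [hσ0]; exact hh
    exact hh'.comp 0 (hσd.hasDerivWithinAt) hmaps
  have hP : HasDerivAt (fun t : ℝ => (1 - c₁ * t) ^ q) (-(q * c₁)) 0 := by
    have h2 := h1.rpow_const (p := q) (Or.inr hq)
    have e2 : -c₁ * q * (1 - c₁ * 0) ^ (q - 1) = -(q * c₁) := by
      rw [mul_zero, sub_zero, Real.one_rpow]; ring
    rw [e2] at h2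
    exact h2
  have hprod : HasDerivWithinAt (fun t : ℝ => (1 - c₁ * t) ^ q * (h ∘ σ) t)
      (-(q * c₁) * (h ∘ σ) 0 + (1 - c₁ * 0) ^ q * (m * 1)) (Set.Ioo 0 δ) 0 :=
    hP.hasDerivWithinAt.mul hH
  have hval0 : (h ∘ σ) 0 = torusTopEigMoment q v := by simp [Function.comp, hσ0, hh_def]
  have e3 : -(q * c₁) * (h ∘ σ) 0 + (1 - c₁ * 0) ^ q * (m * 1) =
      -(q * c₁ * torusTopEigMoment q v) + m := by
    rw [hval0, mul_zero, sub_zero, Real.one_rpow]; ring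
  rw [e3] at hprod
  -- on `(0, δ)` the heat line IS the dilated slice
  have hval : ∀ t ∈ Set.Ioo (0 : ℝ) δ, f t = (1 - c₁ * t) ^ q * (h ∘ σ) t := by
    intro t ht
    have hsm : Torus.IsSmooth (v + σ t • (-z)) := hv.add (Torus.IsSmooth.smul (σ t) hz.neg)
    show torusTopEigMoment q (v + t • Torus.laplacian v) =
      (1 - c₁ * t) ^ q * torusTopEigMoment q (v + σ t • (-z))
    rw [heatLine_shift hΔ (hpos t ht).ne', torusTopEigMoment_smul q (hpos t ht).le hsm]
  have hf0 : f 0 = (1 - c₁ * 0) ^ q * (h ∘ σ) 0 := by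
    rw [hval0, mul_zero, sub_zero, Real.one_rpow, one_mul, hf_def]; simp
  have hfI : HasDerivWithinAt f (-(q * c₁ * torusTopEigMoment q v) + m) (Set.Ioo 0 δ) 0 := by
    refine hprod.congr_of_eventuallyEq ?_ hf0
    filter_upwards [self_mem_nhdsWithin] with t ht using hval t ht
  have hfI' : HasDerivWithinAt f (-(q * c₁ * torusTopEigMoment q v) + m) (Set.Ioi 0) 0 := by
    rw [← Set.Ioi_inter_Iio] at hfI
    exact (hasDerivWithinAt_inter (Iio_mem_nhds hδ0)).mp hfI
  rw [hD, hfI'.derivWithin (uniqueDiffWithinAt_Ioi 0)]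
  ring

/-- **Lower secant bound (`λ₁` core)**: `Δv = −c₁v − z`, `q ≥ 1`, `τ > 0` ⇒
`q c₁ Φ_q(v) + (Φ_q(v) − Φ_q(v − τz))/τ ≤ heatDissipation Φ_q v`. [ours, calibration] -/
theorem heatDissipation_topEigMoment_shift_ge [Nonempty d] {q : ℝ} (hq : 1 ≤ q) {c₁ : ℝ}
    {v z : UnitAddTorus d → EuclideanSpace ℝ d} (hv : Torus.IsSmooth v) (hz : Torus.IsSmooth z)
    (hΔ : Torus.laplacian v = -(c₁ • v) - z) {τ : ℝ} (hτ : 0 < τ) :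
    q * c₁ * torusTopEigMoment q v +
        (torusTopEigMoment q v - torusTopEigMoment q (v + τ • (-z))) / τ ≤
      heatDissipation (torusTopEigMoment q) v := by
  obtain ⟨-, hD⟩ := heatDissipation_topEigMoment_shift hq hv hz hΔ
  have hconv : ConvexOn ℝ univ (fun σ : ℝ => torusTopEigMoment q (v + σ • (-z))) :=
    convexOn_topEigMoment_line hq hv hz.neg
  have hsl := hconv.rightDeriv_le_slope_of_mem_interior (x := 0) (by simp) (mem_univ τ) hτ
  rw [slope_def_field, zero_smul, add_zero, sub_zero] at hsl
  rw [hD, show (torusTopEigMoment q v - torusTopEigMoment q (v + τ • -z)) / τ =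
      -((torusTopEigMoment q (v + τ • -z) - torusTopEigMoment q v) / τ) by ring]
  linarith

/-- **Upper secant bound (`λ₁` core)**: `Δv = −c₁v − z`, `q ≥ 1`, `τ > 0` ⇒
`heatDissipation Φ_q v ≤ q c₁ Φ_q(v) + (Φ_q(v + τz) − Φ_q(v))/τ`. [ours, calibration] -/
theorem heatDissipation_topEigMoment_shift_le [Nonempty d] {q : ℝ} (hq : 1 ≤ q) {c₁ : ℝ}
    {v z : UnitAddTorus d → EuclideanSpace ℝ d} (hv : Torus.IsSmooth v) (hz : Torus.IsSmooth z)
    (hΔ : Torus.laplacian v = -(c₁ • v) - z) {τ : ℝ} (hτ : 0 < τ) :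
    heatDissipation (torusTopEigMoment q) v ≤
      q * c₁ * torusTopEigMoment q v + (torusTopEigMoment q (v + τ • z) - torusTopEigMoment q v) / τ := by
  obtain ⟨-, hD⟩ := heatDissipation_topEigMoment_shift hq hv hz hΔ
  have hconv : ConvexOn ℝ univ (fun σ : ℝ => torusTopEigMoment q (v + σ • (-z))) :=
    convexOn_topEigMoment_line hq hv hz.neg
  have hneg : -τ < 0 := by linarith
  have h1 := hconv.slope_le_leftDeriv_of_mem_interior (x := -τ) (y := 0) (mem_univ _) (by simp) hneg
  have h2 := hconv.leftDeriv_le_rightDeriv_of_mem_interior (x := 0) (by simp)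
  rw [slope_def_field, zero_smul, add_zero, neg_smul, smul_neg, neg_neg, sub_neg_eq_add, zero_add,
    show (torusTopEigMoment q v - torusTopEigMoment q (v + τ • z)) / τ =
      -((torusTopEigMoment q (v + τ • z) - torusTopEigMoment q v) / τ) by ring] at h1
  rw [hD]
  linarith

/-! ## 3. The `−λ₃` core (via `v ↦ −v`) -/

/-- **Lower secant bound, `−λ₃` core.** [ours, calibration] -/
theorem heatDissipation_negBotEigMoment_shift_ge [Nonempty d] {q : ℝ} (hq : 1 ≤ q) {c₁ : ℝ}
    {v z : UnitAddTorus d → EuclideanSpace ℝ d} (hv : Torus.IsSmooth v) (hz : Torus.IsSmooth z)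
    (hΔ : Torus.laplacian v = -(c₁ • v) - z) {τ : ℝ} (hτ : 0 < τ) :
    q * c₁ * torusNegBotEigMoment q v +
        (torusNegBotEigMoment q v - torusNegBotEigMoment q (v + τ • (-z))) / τ ≤
      heatDissipation (torusNegBotEigMoment q) v := by
  have hΔ' : Torus.laplacian (-v) = -(c₁ • -v) - -z := by
    rw [torus_laplacian_neg', hΔ, smul_neg]; abel
  have h := heatDissipation_topEigMoment_shift_ge hq hv.neg hz.neg hΔ' hτ
  rw [heatDissipation_neg, torusTopEigMoment_neg, ← torusNegBotEigMoment_eq_comp_neg q, neg_neg,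
    show -v + τ • z = -(v + τ • -z) by rw [smul_neg, neg_add, neg_neg], torusTopEigMoment_neg] at h
  exact h

/-- **Upper secant bound, `−λ₃` core.** [ours, calibration] -/
theorem heatDissipation_negBotEigMoment_shift_le [Nonempty d] {q : ℝ} (hq : 1 ≤ q) {c₁ : ℝ}
    {v z : UnitAddTorus d → EuclideanSpace ℝ d} (hv : Torus.IsSmooth v) (hz : Torus.IsSmooth z)
    (hΔ : Torus.laplacian v = -(c₁ • v) - z) {τ : ℝ} (hτ : 0 < τ) :
    heatDissipation (torusNegBotEigMoment q) v ≤
      q * c₁ * torusNegBotEigMoment q v +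
        (torusNegBotEigMoment q (v + τ • z) - torusNegBotEigMoment q v) / τ := by
  have hΔ' : Torus.laplacian (-v) = -(c₁ • -v) - -z := by
    rw [torus_laplacian_neg', hΔ, smul_neg]; abel
  have h := heatDissipation_topEigMoment_shift_le hq hv.neg hz.neg hΔ' hτ
  rw [heatDissipation_neg, torusTopEigMoment_neg, ← torusNegBotEigMoment_eq_comp_neg q,
    show -v + τ • -z = -(v + τ • z) by rw [smul_neg, neg_add], torusTopEigMoment_neg] at h
  exact h

/-! ## 4. Two shells -/

section TwoShell

variable [Nonempty d] {q c₁ c₂ : ℝ} {u w : UnitAddTorus d → EuclideanSpace ℝ d}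

omit [Fintype d] [DecidableEq d] [Nonempty d] in
/-- `(u + w) − (c₂ − c₁)⁻¹ • ((c₂ − c₁) • w) = u` (`c₁ < c₂`). [bookkeeping] -/
private theorem twoShell_sub (h12 : c₁ < c₂) :
    (u + w) + (1 / (c₂ - c₁)) • (-((c₂ - c₁) • w)) = u := by
  have hne : c₂ - c₁ ≠ 0 := (sub_pos.mpr h12).ne'
  rw [smul_neg, smul_smul, one_div_mul_cancel hne, one_smul]; abel

omit [Fintype d] [DecidableEq d] [Nonempty d] in
/-- `(u + w) + (c₂ − c₁)⁻¹ • ((c₂ − c₁) • w) = u + 2 • w` (`c₁ < c₂`). [bookkeeping] -/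
private theorem twoShell_add (h12 : c₁ < c₂) :
    (u + w) + (1 / (c₂ - c₁)) • ((c₂ - c₁) • w) = u + (2 : ℝ) • w := by
  have hne : c₂ - c₁ ≠ 0 := (sub_pos.mpr h12).ne'
  rw [smul_smul, one_div_mul_cancel hne, one_smul, two_smul]; abel

/-- **Two-shell sandwich (`λ₁` core).** `Δu = −c₁u`, `Δw = −c₂w`, `c₁ < c₂`, `q ≥ 1`:
`(c₂ − c₁)(Φ(u+w) − Φ(u)) ≤ heatDissipation Φ (u+w) − q c₁ Φ(u+w) ≤ (c₂ − c₁)(Φ(u+2w) − Φ(u+w))`,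
`Φ = ∫(λ₁⁺)^q`. [ours, calibration] -/
theorem twoShell_sandwich_top (hq : 1 ≤ q) (h12 : c₁ < c₂) (hu : Torus.IsSmooth u)
    (hw : Torus.IsSmooth w) (hΔu : Torus.laplacian u = -(c₁ • u))
    (hΔw : Torus.laplacian w = -(c₂ • w)) :
    (c₂ - c₁) * (torusTopEigMoment q (u + w) - torusTopEigMoment q u) ≤
        heatDissipation (torusTopEigMoment q) (u + w) - q * c₁ * torusTopEigMoment q (u + w) ∧
      heatDissipation (torusTopEigMoment q) (u + w) - q * c₁ * torusTopEigMoment q (u + w) ≤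
        (c₂ - c₁) * (torusTopEigMoment q (u + (2 : ℝ) • w) - torusTopEigMoment q (u + w)) := by
  have hgap : 0 < c₂ - c₁ := sub_pos.mpr h12
  have hτ : 0 < 1 / (c₂ - c₁) := by positivity
  have hΔ := laplacian_twoShell hu hw hΔu hΔw
  have hz : Torus.IsSmooth ((c₂ - c₁) • w) := Torus.IsSmooth.smul _ hw
  have h1 := heatDissipation_topEigMoment_shift_ge hq (hu.add hw) hz hΔ hτ
  have h2 := heatDissipation_topEigMoment_shift_le hq (hu.add hw) hz hΔ hτ
  rw [twoShell_sub h12, div_div_eq_mul_div, div_one] at h1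
  rw [twoShell_add h12, div_div_eq_mul_div, div_one] at h2
  constructor
  · linarith [mul_comm (torusTopEigMoment q (u + w) - torusTopEigMoment q u) (c₂ - c₁)]
  · linarith [mul_comm (torusTopEigMoment q (u + (2 : ℝ) • w) - torusTopEigMoment q (u + w)) (c₂ - c₁)]

/-- **Two-shell sandwich (`−λ₃` core).** [ours, calibration] -/
theorem twoShell_sandwich_negBot (hq : 1 ≤ q) (h12 : c₁ < c₂) (hu : Torus.IsSmooth u)
    (hw : Torus.IsSmooth w) (hΔu : Torus.laplacian u = -(c₁ • u))
    (hΔw : Torus.laplacian w = -(c₂ • w)) :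
    (c₂ - c₁) * (torusNegBotEigMoment q (u + w) - torusNegBotEigMoment q u) ≤
        heatDissipation (torusNegBotEigMoment q) (u + w) - q * c₁ * torusNegBotEigMoment q (u + w) ∧
      heatDissipation (torusNegBotEigMoment q) (u + w) - q * c₁ * torusNegBotEigMoment q (u + w) ≤
        (c₂ - c₁) * (torusNegBotEigMoment q (u + (2 : ℝ) • w) - torusNegBotEigMoment q (u + w)) := by
  have hgap : 0 < c₂ - c₁ := sub_pos.mpr h12
  have hτ : 0 < 1 / (c₂ - c₁) := by positivity
  have hΔ := laplacian_twoShell hu hw hΔu hΔw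
  have hz : Torus.IsSmooth ((c₂ - c₁) • w) := Torus.IsSmooth.smul _ hw
  have h1 := heatDissipation_negBotEigMoment_shift_ge hq (hu.add hw) hz hΔ hτ
  have h2 := heatDissipation_negBotEigMoment_shift_le hq (hu.add hw) hz hΔ hτ
  rw [twoShell_sub h12, div_div_eq_mul_div, div_one] at h1
  rw [twoShell_add h12, div_div_eq_mul_div, div_one] at h2
  constructor
  · linarith [mul_comm (torusNegBotEigMoment q (u + w) - torusNegBotEigMoment q u) (c₂ - c₁)]
  · linarith [mul_comm (torusNegBotEigMoment q (u + (2 : ℝ) • w) - torusNegBotEigMoment q (u + w))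
      (c₂ - c₁)]

/-- **(i) No lowering ⇒ coercive at the low-shell rate** (both cores): if the high shell does not
lower the moment, `Φ(u) ≤ Φ(u + w)`, then `q c₁ Φ(u + w) ≤ heatDissipation Φ (u + w)`.
[ours, calibration] -/
theorem twoShell_coercive_of_moment_le (hq : 1 ≤ q) (h12 : c₁ < c₂) (hu : Torus.IsSmooth u)
    (hw : Torus.IsSmooth w) (hΔu : Torus.laplacian u = -(c₁ • u))
    (hΔw : Torus.laplacian w = -(c₂ • w)) :
    (torusTopEigMoment q u ≤ torusTopEigMoment q (u + w) →
        q * c₁ * torusTopEigMoment q (u + w) ≤ heatDissipation (torusTopEigMoment q) (u + w)) ∧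
      (torusNegBotEigMoment q u ≤ torusNegBotEigMoment q (u + w) →
        q * c₁ * torusNegBotEigMoment q (u + w) ≤ heatDissipation (torusNegBotEigMoment q) (u + w)) := by
  have hgap : 0 < c₂ - c₁ := sub_pos.mpr h12
  refine ⟨fun hle => ?_, fun hle => ?_⟩
  · have h := (twoShell_sandwich_top hq h12 hu hw hΔu hΔw).1
    nlinarith
  · have h := (twoShell_sandwich_negBot hq h12 hu hw hΔu hΔw).1
    nlinarith

/-- **(ii) Destructive interference is NECESSARY for a two-shell kill** (both cores): if
`heatDissipation Φ (u+w) < c Φ(u+w)` with `c ≤ q c₁` then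
`(q c₁ − c) Φ(u + w) < (c₂ − c₁)(Φ(u) − Φ(u + w))`, in particular `Φ(u + w) < Φ(u)`.
[ours, calibration] -/
theorem twoShell_moment_lt_of_kill (hq : 1 ≤ q) (h12 : c₁ < c₂) (hu : Torus.IsSmooth u)
    (hw : Torus.IsSmooth w) (hΔu : Torus.laplacian u = -(c₁ • u))
    (hΔw : Torus.laplacian w = -(c₂ • w)) {c : ℝ} (hc : c ≤ q * c₁) :
    (heatDissipation (torusTopEigMoment q) (u + w) < c * torusTopEigMoment q (u + w) →
        (q * c₁ - c) * torusTopEigMoment q (u + w) <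
            (c₂ - c₁) * (torusTopEigMoment q u - torusTopEigMoment q (u + w)) ∧
          torusTopEigMoment q (u + w) < torusTopEigMoment q u) ∧
      (heatDissipation (torusNegBotEigMoment q) (u + w) < c * torusNegBotEigMoment q (u + w) →
        (q * c₁ - c) * torusNegBotEigMoment q (u + w) <
            (c₂ - c₁) * (torusNegBotEigMoment q u - torusNegBotEigMoment q (u + w)) ∧
          torusNegBotEigMoment q (u + w) < torusNegBotEigMoment q u) := by
  have hgap : 0 < c₂ - c₁ := sub_pos.mpr h12
  refine ⟨fun hk => ?_, fun hk => ?_⟩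
  · have h := (twoShell_sandwich_top hq h12 hu hw hΔu hΔw).1
    have hF : 0 ≤ torusTopEigMoment q (u + w) := torusTopEigMoment_nonneg q (u + w)
    have hA : (q * c₁ - c) * torusTopEigMoment q (u + w) <
        (c₂ - c₁) * (torusTopEigMoment q u - torusTopEigMoment q (u + w)) := by nlinarith
    exact ⟨hA, by nlinarith [lt_of_le_of_lt (mul_nonneg (sub_nonneg.mpr hc) hF) hA]⟩
  · have h := (twoShell_sandwich_negBot hq h12 hu hw hΔu hΔw).1
    have hF : 0 ≤ torusNegBotEigMoment q (u + w) := torusNegBotEigMoment_nonneg q (u + w)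
    have hA : (q * c₁ - c) * torusNegBotEigMoment q (u + w) <
        (c₂ - c₁) * (torusNegBotEigMoment q u - torusNegBotEigMoment q (u + w)) := by nlinarith
    exact ⟨hA, by nlinarith [lt_of_le_of_lt (mul_nonneg (sub_nonneg.mpr hc) hF) hA]⟩

/-- **(iii) A sufficient, heat-flow-free KILL TEST** (both cores): if doubling the high shell lowers
the moment fast enough, `(q c₁ − c) Φ(u + w) < (c₂ − c₁)(Φ(u + w) − Φ(u + 2w))`, then
`heatDissipation Φ (u + w) < c Φ(u + w)`. [ours, calibration] -/
theorem twoShell_kill_of_moment_drop (hq : 1 ≤ q) (h12 : c₁ < c₂) (hu : Torus.IsSmooth u)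
    (hw : Torus.IsSmooth w) (hΔu : Torus.laplacian u = -(c₁ • u))
    (hΔw : Torus.laplacian w = -(c₂ • w)) (c : ℝ) :
    ((q * c₁ - c) * torusTopEigMoment q (u + w) <
          (c₂ - c₁) * (torusTopEigMoment q (u + w) - torusTopEigMoment q (u + (2 : ℝ) • w)) →
        heatDissipation (torusTopEigMoment q) (u + w) < c * torusTopEigMoment q (u + w)) ∧
      ((q * c₁ - c) * torusNegBotEigMoment q (u + w) <
          (c₂ - c₁) * (torusNegBotEigMoment q (u + w) - torusNegBotEigMoment q (u + (2 : ℝ) • w)) →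
        heatDissipation (torusNegBotEigMoment q) (u + w) < c * torusNegBotEigMoment q (u + w)) := by
  refine ⟨fun hk => ?_, fun hk => ?_⟩
  · have h := (twoShell_sandwich_top hq h12 hu hw hΔu hΔw).2
    nlinarith
  · have h := (twoShell_sandwich_negBot hq h12 hu hw hΔu hΔw).2
    nlinarith

end TwoShell

/-- **(iv) The heat sieve as a three-moment inequality on `T³`.** For divergence-free shells
`Δu = −c₁u`, `Δw = −c₂w`, `c₁ < c₂`, `q ≥ 1`: `(c₂ − c₁)(Φ(u+w) − Φ(u+2w)) ≤ q c₁ Φ(u+w)`,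
`Φ = ∫(λ₁⁺)^q` (tree `heatDissipation_nonneg_of_admissible`). [ours, calibration] -/
theorem twoShell_moment_drop_le {q c₁ c₂ : ℝ} (hq : 1 ≤ q) (h12 : c₁ < c₂)
    {u w : UnitAddTorus (Fin 3) → EuclideanSpace ℝ (Fin 3)} (hu : Torus.IsSmooth u)
    (hw : Torus.IsSmooth w) (hdu : Torus.IsDivFree u) (hdw : Torus.IsDivFree w)
    (hΔu : Torus.laplacian u = -(c₁ • u)) (hΔw : Torus.laplacian w = -(c₂ • w)) :
    (c₂ - c₁) * (torusTopEigMoment q (u + w) - torusTopEigMoment q (u + (2 : ℝ) • w)) ≤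
      q * c₁ * torusTopEigMoment q (u + w) := by
  have h := (twoShell_sandwich_top hq h12 hu hw hΔu hΔw).2
  have h0 : 0 ≤ heatDissipation (torusTopEigMoment q) (u + w) :=
    heatDissipation_nonneg_of_admissible hq convexOn_lam lipschitzWith_lam
      (fun _ hv hdiv x => lam_strainFlat_nonneg hv hdiv x)
      (fun _ hv hdiv => torusTopEigMoment_eq hv hdiv q) (hu.add hw)
      (Torus.IsDivFree.add (hu.isContDiff (by simp)) (hw.isContDiff (by simp)) hdu hdw)
  nlinarith

/-! ## 5. The class statements -/

/-- **The moment-monotone two-shell class is heat-coercive at the low-shell rate (`λ₁` core).**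
For every real `q ≥ 1` and `c₁`: `HeatCoerciveOn {u + w : Δu = −c₁u, Δw = −c₂w, c₁ < c₂,
Φ_q(u) ≤ Φ_q(u + w)} (∫(λ₁⁺)^q) (q c₁)`. [ours, calibration] -/
theorem heatCoerciveOn_twoShellMono_top [Nonempty d] {q : ℝ} (hq : 1 ≤ q) (c₁ : ℝ) :
    HeatCoerciveOn
      (fun v : UnitAddTorus d → EuclideanSpace ℝ d =>
        ∃ (u w : UnitAddTorus d → EuclideanSpace ℝ d) (c₂ : ℝ), Torus.IsSmooth u ∧ Torus.IsSmooth w ∧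
          Torus.laplacian u = -(c₁ • u) ∧ Torus.laplacian w = -(c₂ • w) ∧ c₁ < c₂ ∧ v = u + w ∧
          torusTopEigMoment q u ≤ torusTopEigMoment q (u + w))
      (torusTopEigMoment q) (q * c₁) := by
  rintro - v - - - ⟨u, w, c₂, hu, hw, hΔu, hΔw, h12, rfl, hle⟩
  exact (twoShell_coercive_of_moment_le hq h12 hu hw hΔu hΔw).1 hle

/-- The same for the `−λ₃` core. [ours, calibration] -/
theorem heatCoerciveOn_twoShellMono_negBot [Nonempty d] {q : ℝ} (hq : 1 ≤ q) (c₁ : ℝ) :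
    HeatCoerciveOn
      (fun v : UnitAddTorus d → EuclideanSpace ℝ d =>
        ∃ (u w : UnitAddTorus d → EuclideanSpace ℝ d) (c₂ : ℝ), Torus.IsSmooth u ∧ Torus.IsSmooth w ∧
          Torus.laplacian u = -(c₁ • u) ∧ Torus.laplacian w = -(c₂ • w) ∧ c₁ < c₂ ∧ v = u + w ∧
          torusNegBotEigMoment q u ≤ torusNegBotEigMoment q (u + w))
      (torusNegBotEigMoment q) (q * c₁) := by
  rintro - v - - - ⟨u, w, c₂, hu, hw, hΔu, hΔw, h12, rfl, hle⟩
  exact (twoShell_coercive_of_moment_le hq h12 hu hw hΔu hΔw).2 hle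

end TopEig

end Summit.NavierStokesRegularity.FunctionalMining

end
-- search for candidate a priori estimates; no regularity claim
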